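/-
Copyright (c) 2026 the pub-hodgecm2 formalisation cell (harness21).  New file.
Origin: seat `prover-pub-hodgecm2-own-b01-g9-0` (unit pub-hodgecm2-own-b01, owner of the B01-O ∕ hM books and of the `ClosedAsPrinted` pen;
RECIPE v1.3 step (α′), `HOME/b01/B01-CLOSED-ASPRINTED-RECIPE.md` §3.1), 2026-08-22 — PORT JOIN part 3′: LANE (α)'s closing term
`PortJoin.hc_cm_of_thm418C` (`CorCM/PortJoin/Closed.lean` = item6-p2 v4 cc0bed774ef6, owner own-htheta) with its ONE displayed binder `h418` LOCALISED to the
fields at which the ported package actually applies it — Galois CM fields `F` with `6 ≤ [F:ℚ]` — by consuming BY NAME the package's field-local face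
period head `HodgeCM.Model.periodNV_face_anyEmb_R2J` (`Summits/HodgeConjecture/HodgeCM/Model/FacePeriodThmF.lean` :98, port layer 97; package
`Model/FacePeriodThmF.lean` :97 of HodgeCMPerL run 82) instead of the re-globalised record instance `periodThmF_r20JBUARM` / the PTF head.
KERNEL only: ONE theorem, ONE displayed Prop binder (`h418`, a CITED reading — T5 class = `PortJoin/Closed.lean`'s); `hGRU` is the tree theorem
`GRConstruction.gru_shape`; count-neutral until the referees say otherwise.  PORT-GATED (L39 ∕ L67–72 ∕ L96 ∕ L97 oleans + PORT JOIN part 2).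
HC_CM is NOT proved by this file: `hc_cm_of_thm418C_local` is HC_CM MODULO the displayed reading `h418` (r8 `Thm418C`, STRONGER-IN-X, Δ2 bridge open).
-/
import Summits.HodgeConjecture.HodgeCM.Model.FacePeriodThmF
import Summits.HodgeConjecture.CorCM.PortJoin.PeriodThmF
import Summits.HodgeConjecture.CorCM.Model.CMAbelianVarietyEigenbasisRealisedHolds
import Literature.NumberTheory.GelbartRogawski1991.CompatibleSplittingCM
import HarnessLib

set_option autoImplicit false

/-!
# PORT JOIN, part 3′: HC_CM from the reading r8 `Thm418C` demanded ONLY at Galois CM fields of degree ≥ 6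

`PortJoin.hc_cm_of_thm418C` (part 3) displays `h418` over EVERY ported CM-field code `L : HodgeCM.CMField` (any degree, Galois or not) and
every hermitian 3-space there, because the ported PTF head `HodgeCM.Model.periodThmF_picardCM_of_GRU_thm418C` states its binder that way; the
package APPLIES the binder only at the face field (`Model/E2InstanceOGR20AEPISTR2DJWHHTCGJB.lean` :95, `… (h418 V hcan) …`).  The package's own
leaf `HodgeCM.Model.periodNV_face_anyEmb_R2J` (x1 g2 / own-htheta, run 82) carries the field-LOCAL binder
`h418 : ∀ {ι₁ : F →+* ℂ} (V : HermSpace3 F ι₁), (mk ι₁).embedding = ι₁ → ∀ a₀, (liuDictionaryPin … V …).Thm418C` at a Galois CM field `F`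
with `6 ≤ [F:ℚ]`; composing it with PORT JOIN part 2's `hc_cm_closed_of_pkg_periodThmF` gives `HC_CM` from `h418` restricted to those fields.
EFFECT for the as-printed programme (RECIPE v1.3 §3.3 `ClosedAsPrinted`): the Δ2 instance `Thm418AsPrintedC … → (liuDictionaryPin …).Thm418C`
(pin-3 `…AppendixCAtDictionary`) is owed only where the S-lane's tree carriers exist (`Model.heckeTranslatesFamilyOf … (h6 : 6 ≤ [F:ℚ])`,
`Model.sec42DataOf`'s honest branch `4 ≤ [F:ℚ]`).  HC_CM is NOT proved here.
-/

noncomputable section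

namespace Summit.HodgeConjecture.CorCM.PortJoin

open Literature.AlgebraicGeometry.HodgeTheory Literature.NumberTheory.Automorphic.PicardCM
open Literature.NumberTheory.Automorphic Literature.NumberTheory.GelbartRogawski1991 NumberField

/-- **HC_CM from the PORTED package, modulo the reading r8 `Thm418C` of [Liu2021, Thm. 4.18] on the pinned dictionary AT GALOIS CM FIELDS OF
DEGREE ≥ 6 ONLY** (every canonical complex embedding `ι₁` of such a field, every hermitian 3-space `V` there, every real scalar class `a₀`).
KERNEL: PORT JOIN part 2's `hc_cm_closed_of_pkg_periodThmF` at the `PeriodThmF` family assembled field by field from the ported leaf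
`HodgeCM.Model.periodNV_face_anyEmb_R2J` (package `Model/FacePeriodThmF.lean` :97) at the record rows `(hHD, hI, h₁)_holds`,
`h₃ := cmAbelianVarietyRealised_of_eigenbasis … cmAbelianVarietyEigenbasisRealised_holds`, `hA := arapura2012_cor_15_4_6_holds`, the five
[GR91, Prop. 3.1.1] pins read off the tree theorem `GRConstruction.gru_shape` exactly as the package's record instance `periodThmF_r20JBUARM` :132
reads them off its `hGRU` binder (`SInstance.GRU.hGR … hGR₃`), the exponent table `ArchSideTerm.muSlotZero`, and [DeligneMilne1982 Thm. 6.20]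
proved (`deligneMilne1982_Thm_6_20_full_holds`).  Same proposition family as `PortJoin.hc_cm_of_thm418C`'s binder, SMALLER index set.
HC_CM is NOT proved unconditionally: `h418` is CITED (reading r8, STRONGER-IN-X per HM-DELTA2-CLARITY; the Δ2 bridge is open).
[cite: Liu2021, Thm. 4.18 (FJcycle.tex l. 2232–2245), proof map (4.2) l. 2251–2253] [cite: GelbartRogawski1991, §3.1 Prop. 3.1.1 p. 455 L1–3]
[cite: DeligneMilne1982Tannakian, §6 Thm. 6.20 (Riemann), p. 212] -/
theorem hc_cm_of_thm418C_local
    (h418 : ∀ (F : HodgeCM.CMField), IsGalois ℚ F → 6 ≤ Module.finrank ℚ F →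
      ∀ {ι₁ : F →+* ℂ} (V : HodgeCM.HermSpace3 F ι₁), (NumberField.InfinitePlace.mk ι₁).embedding = ι₁ →
      ∀ a₀ : HodgeCM.Model.LiuIndex.RealScalar F,
      (HodgeCM.Model.liuDictionaryPin exists_isReal_hodgeModel_holds hodgePQ_independent_of_hodgeModel_holds
          BallQuotient.ballQuotientUniformised_holds
          (cmAbelianVarietyRealised_of_eigenbasis exists_isReal_hodgeModel_holds hodgePQ_independent_of_hodgeModel_holds
            cmAbelianVarietyEigenbasisRealised_holds)
          Literature.NumberTheory.Transcendental.arapura2012_cor_15_4_6_holds V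
          (HodgeCM.Model.LiuIndex.I V (HodgeCM.Model.LiuIndex.repAt a₀) (HodgeCM.Model.LiuIndex.muLiu ι₁ HodgeCM.Model.LiuIndex.GramClass.rep))
          (HodgeCM.Model.LiuIndex.line V (HodgeCM.Model.LiuIndex.repAt a₀)
            (HodgeCM.Model.LiuIndex.muLiu ι₁ HodgeCM.Model.LiuIndex.GramClass.rep))).Thm418C) :
    HC_CM :=
  hc_cm_closed_of_pkg_periodThmF
    (cmAbelianVarietyRealised_of_eigenbasis exists_isReal_hodgeModel_holds hodgePQ_independent_of_hodgeModel_holds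
      cmAbelianVarietyEigenbasisRealised_holds)
    fun F hG h6 f ι₁ hadm V => by
    haveI : IsGalois ℚ F := hG
    exact HodgeCM.Model.periodNV_face_anyEmb_R2J exists_isReal_hodgeModel_holds hodgePQ_independent_of_hodgeModel_holds
      BallQuotient.ballQuotientUniformised_holds
      (cmAbelianVarietyRealised_of_eigenbasis exists_isReal_hodgeModel_holds hodgePQ_independent_of_hodgeModel_holds
        cmAbelianVarietyEigenbasisRealised_holds)
      Literature.NumberTheory.Transcendental.arapura2012_cor_15_4_6_holds
      (@HodgeCM.Model.SInstance.GRU.hGR GRConstruction.gru_shape) (@HodgeCM.Model.SInstance.GRU.hGR₀ GRConstruction.gru_shape)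
      (@HodgeCM.Model.SInstance.GRU.hGR₁ GRConstruction.gru_shape) (@HodgeCM.Model.SInstance.GRU.hGR₂ GRConstruction.gru_shape)
      (@HodgeCM.Model.SInstance.GRU.hGR₃ GRConstruction.gru_shape) @HodgeCM.Model.ArchSideTerm.muSlotZero
      deligneMilne1982_Thm_6_20_full_holds F h6 f hadm V (h418 F hG h6)

/-- `hc_cm_of_thm418C` (PORT JOIN part 3) is the special case of `hc_cm_of_thm418C_local` in which the reading is granted at every CM field:
the binder of part 3 restricts to the local one. -/
example
    (h418 : ∀ {L : HodgeCM.CMField} {ι₁ : L →+* ℂ} (V : HodgeCM.HermSpace3 L ι₁),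
      (NumberField.InfinitePlace.mk ι₁).embedding = ι₁ → ∀ a₀ : HodgeCM.Model.LiuIndex.RealScalar L,
      (HodgeCM.Model.liuDictionaryPin exists_isReal_hodgeModel_holds hodgePQ_independent_of_hodgeModel_holds
          BallQuotient.ballQuotientUniformised_holds
          (cmAbelianVarietyRealised_of_eigenbasis exists_isReal_hodgeModel_holds hodgePQ_independent_of_hodgeModel_holds
            cmAbelianVarietyEigenbasisRealised_holds)
          Literature.NumberTheory.Transcendental.arapura2012_cor_15_4_6_holds V
          (HodgeCM.Model.LiuIndex.I V (HodgeCM.Model.LiuIndex.repAt a₀) (HodgeCM.Model.LiuIndex.muLiu ι₁ HodgeCM.Model.LiuIndex.GramClass.rep))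
          (HodgeCM.Model.LiuIndex.line V (HodgeCM.Model.LiuIndex.repAt a₀)
            (HodgeCM.Model.LiuIndex.muLiu ι₁ HodgeCM.Model.LiuIndex.GramClass.rep))).Thm418C) :
    HC_CM :=
  hc_cm_of_thm418C_local fun _ _ _ _ V hcan a₀ => h418 V hcan a₀

end Summit.HodgeConjecture.CorCM.PortJoin

end
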